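import Mathlib.Data.ZMod.Units
import Mathlib.Data.Nat.Totient
import Mathlib.Data.Nat.Factorization.Induction
import Mathlib.FieldTheory.Finite.Basic
import Mathlib.Tactic
import Literature.NumberTheory.QuadraticFields.KroneckerSplitting
import HarnessLib

/-!
# Counting pairs modulo `f` with invertible norm: `#{(u,v) ∈ (ℤ/f)² : u² + tuv − mv² ∈ (ℤ/f)ˣ}`
# `= φ(f) · ∏_{p^k ∥ f} p^{k−1} (p + 1 − ρ_p)`, `ρ_p = #{y ∈ 𝔽_p : y² = t² + 4m}` (Cox, Thm. 7.24 / Ex. 7.29)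

Topic `NumberTheory/QuadraticFields`, namespace `Literature.NumberTheory.QuadraticFields.RingClass`.
Elementary counting (theorems only) behind the order of `(𝒪_K/f𝒪_K)^*` for a quadratic field with
integral basis `(1, ω)`, `ω² = m + tω` (Cox, *Primes of the form x² + ny²*, proof of Thm. 7.24 and
Exercise 7.29: `|(𝒪_K/f𝒪_K)^*| = Φ_K(f) = f² ∏_{p ∣ f} (1 − 1/p)(1 − (d_K/p)/p)`), for the function
`normUnitPairs t m n = #{(u, v) ∈ (ℤ/n)² : u² + tuv − mv² ∈ (ℤ/n)ˣ}`:

* `card_normUnitPairs_mul` — multiplicativity in `n` (Chinese remainder theorem);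
* `card_normUnitPairs_prime_pow` — `N(p^k) = p^{2(k−1)} N(p)` (a pair is invertible-normed modulo `p^k`
  iff it is modulo `p`; fibres of `(ℤ/p^k)² → (ℤ/p)²`);
* `card_normUnitPairs_prime` — `N(p) = p² − 1 − (p − 1)ρ_p` for an odd prime `p`, where
  `ρ_p = #{y ∈ 𝔽_p : y² = t² + 4m}` (completing the square `4Q = (2u+tv)² − (t²+4m)v²`);
  `card_normUnitPairs_two` — the case `p = 2`.

## References

* D. A. Cox, *Primes of the form x² + ny²*, 2nd ed., Wiley (2013), §7.D Thm. 7.24 (the formula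
  `h(𝒪) = h(𝒪_K) f/[𝒪_K^*:𝒪^*] ∏(1 − (d_K/p)/p)`) and Exercise 7.29. [cite: Cox2013, §7.D Thm. 7.24]
-/

namespace Literature.NumberTheory.QuadraticFields.RingClass

open Finset

/-- The norm form `Q(u, v) = u² + tuv − mv²` over `ℤ/n`. [cite: Cox2013, §7.A (7.1)] -/
def normFormZMod (t m : ℤ) (n : ℕ) (uv : ZMod n × ZMod n) : ZMod n :=
  uv.1 ^ 2 + (t : ZMod n) * uv.1 * uv.2 - (m : ZMod n) * uv.2 ^ 2

/-- The pairs modulo `n` with invertible norm. [cite: Cox2013, §7.D Exercise 7.29] -/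
def NormUnitPairs (t m : ℤ) (n : ℕ) : Type := {uv : ZMod n × ZMod n // IsUnit (normFormZMod t m n uv)}

/-- `NormUnitPairs t m n` is finite for `n ≠ 0`. -/
instance (t m : ℤ) (n : ℕ) [NeZero n] : Finite (NormUnitPairs t m n) := by
  unfold NormUnitPairs; infer_instance

variable (t m : ℤ)

/-- A ring homomorphism `ZMod n → R` transports the norm form. [cite: Cox2013, §7.A (7.1)] -/
theorem map_normFormZMod {n : ℕ} {R : Type*} [CommRing R] (g : ZMod n →+* R) (uv : ZMod n × ZMod n) :
    g (normFormZMod t m n uv) = (g uv.1) ^ 2 + (t : R) * g uv.1 * g uv.2 - (m : R) * (g uv.2) ^ 2 := by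
  simp [normFormZMod, map_add, map_sub, map_mul, map_pow, map_intCast]

/-! ### Multiplicativity -/

/-- **CRT**: `N(ab) = N(a) N(b)` for coprime `a, b`. [cite: Cox2013, §7.D Exercise 7.29] -/
theorem card_normUnitPairs_mul {a c : ℕ} (h : a.Coprime c) :
    Nat.card (NormUnitPairs t m (a * c)) = Nat.card (NormUnitPairs t m a) * Nat.card (NormUnitPairs t m c) := by
  classical
  let e := ZMod.chineseRemainder h
  -- `(ℤ/ac)² ≃ (ℤ/a)² × (ℤ/c)²`, compatible with `Q`
  let E : ZMod (a * c) × ZMod (a * c) ≃ (ZMod a × ZMod a) × (ZMod c × ZMod c) :=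
    { toFun := fun uv => (((e uv.1).1, (e uv.2).1), ((e uv.1).2, (e uv.2).2))
      invFun := fun w => (e.symm (w.1.1, w.2.1), e.symm (w.1.2, w.2.2))
      left_inv := fun uv => by simp
      right_inv := fun w => by simp }
  have hQ : ∀ uv : ZMod (a * c) × ZMod (a * c),
      IsUnit (normFormZMod t m (a * c) uv) ↔
        IsUnit (normFormZMod t m a (E uv).1) ∧ IsUnit (normFormZMod t m c (E uv).2) := by
    intro uv
    rw [← isUnit_map_iff e (normFormZMod t m (a * c) uv), Prod.isUnit_iff]
    have h1 := map_normFormZMod t m e.toRingHom uv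
    simp only [RingEquiv.toRingHom_eq_coe, RingHom.coe_coe] at h1
    rw [h1]
    simp only [normFormZMod, E, Equiv.coe_fn_mk, Prod.fst_add, Prod.snd_add, Prod.fst_sub, Prod.snd_sub,
      Prod.fst_mul, Prod.snd_mul, Prod.pow_fst, Prod.pow_snd, Prod.fst_intCast, Prod.snd_intCast]
  let F : NormUnitPairs t m (a * c) ≃ NormUnitPairs t m a × NormUnitPairs t m c :=
    (Equiv.subtypeEquiv E hQ).trans Equiv.subtypeProdEquivProd
  rw [Nat.card_congr F, Nat.card_prod]

/-- `N(1) = 1`. [cite: Cox2013, §7.D Exercise 7.29] -/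
theorem card_normUnitPairs_one : Nat.card (NormUnitPairs t m 1) = 1 := by
  haveI : Unique (NormUnitPairs t m 1) :=
    { default := ⟨(0, 0), isUnit_of_subsingleton _⟩
      uniq := fun x => Subtype.ext (Subsingleton.elim _ _) }
  exact Nat.card_unique

/-! ### Prime powers -/

/-- In `ℤ/p^k`, an element is a unit iff its image in `ℤ/p` is. [cite: Cox2013, §7.D Exercise 7.29 (units modulo p^k)] -/
theorem isUnit_iff_isUnit_castHom {p k : ℕ} (hp : p.Prime) (hk : 0 < k) (x : ZMod (p ^ k)) :
    IsUnit x ↔ IsUnit (ZMod.castHom (dvd_pow_self p hk.ne') (ZMod p) x) := by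
  haveI : NeZero (p ^ k) := ⟨pow_ne_zero k hp.ne_zero⟩
  rw [← ZMod.natCast_zmod_val x, map_natCast, ZMod.isUnit_iff_coprime, ZMod.isUnit_iff_coprime,
    Nat.coprime_pow_right_iff hk]

/-- For a surjective additive homomorphism of finite groups, the number of elements whose image
satisfies a predicate is `|ker| ·` the number of images satisfying it. [cite: Cox2013, §7.D Exercise 7.29 (counting modulo p^k)] -/
theorem card_subtype_comp_eq {A B : Type*} [AddCommGroup A] [AddCommGroup B] [Finite A] [Finite B]
    (g : A →+ B) (hg : Function.Surjective g) (P : B → Prop) :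
    Nat.card {a : A // P (g a)} = Nat.card g.ker * Nat.card {b : B // P b} := by
  classical
  haveI := Fintype.ofFinite B
  have e := (Equiv.sigmaSubtypeFiberEquivSubtype (f := g) (p := fun a => P (g a)) (q := P) (fun _ => Iff.rfl)).symm
  rw [Nat.card_congr e, Nat.card_sigma]
  have hfib : ∀ y : {b : B // P b}, Nat.card {a : A // g a = y} = Nat.card g.ker := by
    intro y
    obtain ⟨a₀, ha₀⟩ := hg y
    refine Nat.card_congr
      { toFun := fun a => ⟨a.1 - a₀, by rw [AddMonoidHom.mem_ker, map_sub, a.2, ha₀, sub_self]⟩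
        invFun := fun z => ⟨z.1 + a₀, by rw [map_add, (AddMonoidHom.mem_ker).1 z.2, ha₀, zero_add]⟩
        left_inv := fun a => Subtype.ext (by simp)
        right_inv := fun z => Subtype.ext (by simp) }
  simp only [hfib, Finset.sum_const, Finset.card_univ, smul_eq_mul, ← Nat.card_eq_fintype_card]
  ring

/-- **`N(p^k) = p^{2(k−1)} N(p)`** for a prime `p` and `k ≥ 1`. [cite: Cox2013, §7.D Exercise 7.29] -/
theorem card_normUnitPairs_prime_pow {p k : ℕ} (hp : p.Prime) (hk : 0 < k) :
    Nat.card (NormUnitPairs t m (p ^ k)) = p ^ (2 * (k - 1)) * Nat.card (NormUnitPairs t m p) := by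
  classical
  haveI : NeZero (p ^ k) := ⟨pow_ne_zero k hp.ne_zero⟩
  haveI : NeZero p := ⟨hp.ne_zero⟩
  let π : ZMod (p ^ k) →+* ZMod p := ZMod.castHom (dvd_pow_self p hk.ne') (ZMod p)
  have hπ : Function.Surjective π := ZMod.castHom_surjective _
  let g : ZMod (p ^ k) × ZMod (p ^ k) →+ ZMod p × ZMod p :=
    (π.toAddMonoidHom.comp (AddMonoidHom.fst _ _)).prod (π.toAddMonoidHom.comp (AddMonoidHom.snd _ _))
  have hgapp : ∀ uv, g uv = (π uv.1, π uv.2) := fun uv => rfl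
  have hg : Function.Surjective g := by
    rintro ⟨x, y⟩
    obtain ⟨u, rfl⟩ := hπ x
    obtain ⟨v, rfl⟩ := hπ y
    exact ⟨(u, v), rfl⟩
  -- the predicate transports
  have hP : ∀ uv : ZMod (p ^ k) × ZMod (p ^ k),
      IsUnit (normFormZMod t m (p ^ k) uv) ↔ IsUnit (normFormZMod t m p (g uv)) := by
    intro uv
    rw [isUnit_iff_isUnit_castHom hp hk, hgapp]
    have := map_normFormZMod t m π uv
    rw [show ZMod.castHom (dvd_pow_self p hk.ne') (ZMod p) = π from rfl, this, normFormZMod]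
  have h1 : Nat.card (NormUnitPairs t m (p ^ k)) =
      Nat.card {uv : ZMod (p ^ k) × ZMod (p ^ k) // IsUnit (normFormZMod t m p (g uv))} :=
    Nat.card_congr (Equiv.subtypeEquivRight hP)
  rw [h1, card_subtype_comp_eq g hg (fun b => IsUnit (normFormZMod t m p b))]
  -- `|ker g| = p^{2(k-1)}`
  have hker : Nat.card g.ker * (p ^ 2) = p ^ (2 * k) := by
    have h := AddSubgroup.card_mul_index g.ker
    rw [AddSubgroup.index_ker, AddMonoidHom.range_eq_top.2 hg, AddSubgroup.card_top, Nat.card_prod,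
      Nat.card_prod, Nat.card_zmod, Nat.card_zmod] at h
    rw [pow_two, h]; ring
  have hker' : Nat.card g.ker = p ^ (2 * (k - 1)) := by
    have hp2 : 0 < p ^ 2 := pow_pos hp.pos 2
    apply Nat.eq_of_mul_eq_mul_right hp2
    rw [hker, ← pow_add]
    congr 1; omega
  rw [hker']
  rfl

/-! ### A prime `p`: zeros of the norm form over `𝔽_p` -/

/-- Complementary subtypes of a finite type have complementary cardinalities. [cite: Cox2013, §7.D Exercise 7.29 (counting)] -/
theorem card_subtype_add_card_subtype_not {α : Type*} [Finite α] (P : α → Prop) :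
    Nat.card {a : α // P a} + Nat.card {a : α // ¬ P a} = Nat.card α := by
  classical
  haveI := Fintype.ofFinite α
  rw [Nat.card_eq_fintype_card, Nat.card_eq_fintype_card, Nat.card_eq_fintype_card,
    Fintype.card_subtype, Fintype.card_subtype, Finset.card_filter_add_card_filter_not, Finset.card_univ]

/-- **Zeros of `w² = D v²` over `𝔽_p`**: `1 + (p − 1) · #{y : y² = D}`. [cite: Cox2013, §7.D Exercise 7.29] -/
theorem card_sq_eq_mul_sq {p : ℕ} [hp : Fact p.Prime] (D : ZMod p) :
    Nat.card {wv : ZMod p × ZMod p // wv.1 ^ 2 = D * wv.2 ^ 2} =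
      1 + (p - 1) * Nat.card {y : ZMod p // y ^ 2 = D} := by
  classical
  -- split by `v = 0`
  let E : {wv : ZMod p × ZMod p // wv.1 ^ 2 = D * wv.2 ^ 2} ≃
      {w : ZMod p // w ^ 2 = 0} ⊕ {wv : ZMod p × ZMod p // wv.2 ≠ 0 ∧ wv.1 ^ 2 = D * wv.2 ^ 2} :=
    { toFun := fun x => if h : x.1.2 = 0 then Sum.inl ⟨x.1.1, by have := x.2; rw [h] at this; simpa using this⟩
        else Sum.inr ⟨x.1, h, x.2⟩
      invFun := fun y => match y with
        | Sum.inl w => ⟨(w.1, 0), by simp [w.2]⟩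
        | Sum.inr wv => ⟨wv.1, wv.2.2⟩
      left_inv := fun x => by
        by_cases h : x.1.2 = 0
        · simp only [h, dif_pos]; apply Subtype.ext; ext <;> simp [h]
        · simp only [h, dif_neg, not_false_eq_true]
      right_inv := fun y => by
        rcases y with w | wv
        · simp
        · simp only [wv.2.1, dif_neg, not_false_eq_true] }
  rw [Nat.card_congr E, Nat.card_sum]
  congr 1
  · -- `w² = 0 ↔ w = 0`
    have : {w : ZMod p // w ^ 2 = 0} = {w : ZMod p // w = 0} := by
      congr 1; ext w; exact ⟨fun h => pow_eq_zero_iff two_ne_zero |>.1 h, fun h => by rw [h]; ring⟩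
    rw [this, Nat.card_unique]
  · -- `(w, v) ↦ (v, w/v)`
    let F : {wv : ZMod p × ZMod p // wv.2 ≠ 0 ∧ wv.1 ^ 2 = D * wv.2 ^ 2} ≃
        {v : ZMod p // v ≠ 0} × {y : ZMod p // y ^ 2 = D} :=
      { toFun := fun x => (⟨x.1.2, x.2.1⟩, ⟨x.1.1 * x.1.2⁻¹, by
          have h := x.2.2; have hv := x.2.1
          field_simp; linear_combination h⟩)
        invFun := fun y => ⟨(y.2.1 * y.1.1, y.1.1), y.1.2, by have := y.2.2; rw [mul_pow, this]⟩
        left_inv := fun x => by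
          apply Subtype.ext; ext
          · simp only; rw [inv_mul_cancel_right₀ x.2.1]
          · rfl
        right_inv := fun y => by
          ext
          · rfl
          · simp only; rw [mul_inv_cancel_right₀ y.1.2] }
    rw [Nat.card_congr F, Nat.card_prod]
    congr 1
    rw [← Nat.card_congr (unitsEquivNeZero (G₀ := ZMod p)), Nat.card_eq_fintype_card, ZMod.card_units]

/-- **`N(p) = p² − 1 − (p − 1) ρ_p` for an odd prime `p`**, `ρ_p = #{y ∈ 𝔽_p : y² = t² + 4m}`:
completing the square, `4Q(u,v) = (2u + tv)² − (t² + 4m) v²`. [cite: Cox2013, §7.D Thm. 7.24 and Exercise 7.29] -/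
theorem card_normUnitPairs_prime {p : ℕ} [hp : Fact p.Prime] (hp2 : p ≠ 2) :
    Nat.card (NormUnitPairs t m p) + (1 + (p - 1) * Nat.card {y : ZMod p // y ^ 2 = ((t ^ 2 + 4 * m : ℤ) : ZMod p)})
      = p ^ 2 := by
  classical
  have h2 : (2 : ZMod p) ≠ 0 := Literature.NumberTheory.QuadraticFields.Quadratic.two_ne_zero_zmod hp2
  set D : ZMod p := ((t ^ 2 + 4 * m : ℤ) : ZMod p) with hD
  -- units = non-zeros
  have hN : Nat.card (NormUnitPairs t m p) = Nat.card {uv : ZMod p × ZMod p // normFormZMod t m p uv ≠ 0} := by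
    unfold NormUnitPairs
    exact Nat.card_congr (Equiv.subtypeEquivRight fun uv => isUnit_iff_ne_zero)
  -- zeros ≃ solutions of `w² = D v²`
  let ψ : ZMod p × ZMod p ≃ ZMod p × ZMod p :=
    { toFun := fun uv => (2 * uv.1 + (t : ZMod p) * uv.2, uv.2)
      invFun := fun wv => ((wv.1 - (t : ZMod p) * wv.2) * 2⁻¹, wv.2)
      left_inv := fun uv => Prod.ext (by simp only; field_simp; ring) rfl
      right_inv := fun wv => Prod.ext (by simp only; field_simp; ring) rfl }
  have hZ : Nat.card {uv : ZMod p × ZMod p // ¬ normFormZMod t m p uv ≠ 0} =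
      Nat.card {wv : ZMod p × ZMod p // wv.1 ^ 2 = D * wv.2 ^ 2} := by
    refine Nat.card_congr (Equiv.subtypeEquiv ψ fun uv => ?_)
    rw [not_not, normFormZMod, hD]
    simp only [ψ, Equiv.coe_fn_mk]
    push_cast
    constructor
    · intro h; linear_combination 4 * h
    · intro h
      have h4 : (4 : ZMod p) ≠ 0 := by
        have : (4 : ZMod p) = 2 * 2 := by norm_num
        rw [this]; exact mul_ne_zero h2 h2
      apply (mul_right_inj' h4).1
      linear_combination h
  have htot := card_subtype_add_card_subtype_not (α := ZMod p × ZMod p) (fun uv => normFormZMod t m p uv ≠ 0)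
  rw [← hN, hZ, card_sq_eq_mul_sq, Nat.card_prod, Nat.card_zmod] at htot
  rw [htot, pow_two]

/-! ### The number of prime forms `ρ_p = #{b mod 2p : b² ≡ −d (mod 4p)}` as a square-root count -/

/-- `b² + d ≡ 0 (mod 4)` forces `b ≡ d (mod 2)` (and conversely when `d ≡ 0, 3 (mod 4)`). [cite: Cox2013, §2.A (b ≡ D mod 2 for forms (a,b,c) of discriminant D)] -/
theorem mod_two_eq_of_four_dvd {b d : ℕ} (h : 4 ∣ b ^ 2 + d) : b % 2 = d % 2 := by
  obtain ⟨k, hk⟩ := h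
  rcases Nat.even_or_odd b with ⟨r, hr⟩ | ⟨r, hr⟩
  · subst hr
    have h4 : (r + r) ^ 2 = 4 * r ^ 2 := by ring
    rw [h4] at hk
    omega
  · subst hr
    have h4 : (2 * r + 1) ^ 2 = 4 * (r ^ 2 + r) + 1 := by ring
    rw [h4] at hk
    omega

/-- Conversely, for `d ≡ 0` or `3 (mod 4)` and `b ≡ d (mod 2)`, `4 ∣ b² + d`. [cite: Cox2013, §2.A (b ≡ D mod 2 for forms (a,b,c) of discriminant D)] -/
theorem four_dvd_of_mod_two_eq {b d : ℕ} (hd : d % 4 = 0 ∨ d % 4 = 3) (hb : b % 2 = d % 2) : 4 ∣ b ^ 2 + d := by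
  rcases Nat.even_or_odd b with ⟨r, hr⟩ | ⟨r, hr⟩
  · subst hr
    have : (r + r) ^ 2 = 4 * r ^ 2 := by ring
    rw [this]; omega
  · subst hr
    have : (2 * r + 1) ^ 2 = 4 * (r ^ 2 + r) + 1 := by ring
    rw [this]; omega

/-- **`#{b < 2p : 4p ∣ b² + d} = #{y ∈ 𝔽_p : y² = −d}`** for an odd prime `p` and `−d ≡ 0, 1 (mod 4)`
(the number of prime forms `(p, b, ·)` of discriminant `−d`, Cox §2/§7, equals `1 + (−d/p)`).
[cite: Cox2013, §7.D Thm. 7.24 (the Kronecker symbol (d_K/p))] -/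
theorem ncard_primeForms_eq {p : ℕ} [hp : Fact p.Prime] (hp2 : p ≠ 2) {d : ℕ} (hd : d % 4 = 0 ∨ d % 4 = 3) :
    Set.ncard {b : ℕ | b < 2 * p ∧ (4 * (p : ℤ)) ∣ ((b : ℤ) ^ 2 + (d : ℤ))} =
      Nat.card {y : ZMod p // y ^ 2 = -(d : ZMod p)} := by
  classical
  have hpodd : p % 2 = 1 := Nat.odd_iff.1 (hp.out.odd_of_ne_two hp2)
  have hcop : Nat.Coprime 2 p := (Nat.coprime_primes Nat.prime_two hp.out).2 (Ne.symm hp2)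
  have hcop4 : Nat.Coprime 4 p := by
    have : (4 : ℕ) = 2 ^ 2 := by norm_num
    rw [this]; exact Nat.Coprime.pow_left 2 hcop
  have hset : {b : ℕ | b < 2 * p ∧ (4 * (p : ℤ)) ∣ ((b : ℤ) ^ 2 + (d : ℤ))} =
      {b : ℕ | b < 2 * p ∧ 4 * p ∣ b ^ 2 + d} := by
    ext b
    simp only [Set.mem_setOf_eq]
    rw [show (4 * (p : ℤ)) = ((4 * p : ℕ) : ℤ) by push_cast; ring,
      show ((b : ℤ) ^ 2 + (d : ℤ)) = ((b ^ 2 + d : ℕ) : ℤ) by push_cast; ring, Int.natCast_dvd_natCast]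
  rw [hset, ← Nat.card_coe_set_eq]
  have hwd : ∀ b : {b : ℕ | b < 2 * p ∧ 4 * p ∣ b ^ 2 + d}, ((b.1 : ℕ) : ZMod p) ^ 2 = -(d : ZMod p) := by
    rintro ⟨b, -, hdiv⟩
    have hpd : p ∣ b ^ 2 + d := dvd_trans (Dvd.intro_left 4 rfl) hdiv
    have h0 : ((b ^ 2 + d : ℕ) : ZMod p) = 0 := (ZMod.natCast_eq_zero_iff _ _).2 hpd
    push_cast at h0
    linear_combination h0
  refine Nat.card_eq_of_bijective
    (fun b => (⟨((b.1 : ℕ) : ZMod p), hwd b⟩ : {y : ZMod p // y ^ 2 = -(d : ZMod p)})) ⟨?_, ?_⟩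
  · rintro ⟨b₁, hb₁, h₁⟩ ⟨b₂, hb₂, h₂⟩ h
    have hval : ((b₁ : ℕ) : ZMod p) = ((b₂ : ℕ) : ZMod p) := congrArg Subtype.val h
    have hmodp : b₁ ≡ b₂ [MOD p] := (ZMod.natCast_eq_natCast_iff _ _ _).1 hval
    have hmod2 : b₁ ≡ b₂ [MOD 2] := by
      change b₁ % 2 = b₂ % 2
      rw [mod_two_eq_of_four_dvd (dvd_trans (Dvd.intro p rfl) h₁),
        mod_two_eq_of_four_dvd (dvd_trans (Dvd.intro p rfl) h₂)]
    have h2p : b₁ ≡ b₂ [MOD 2 * p] := (Nat.modEq_and_modEq_iff_modEq_mul hcop).1 ⟨hmod2, hmodp⟩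
    exact Subtype.ext (Nat.ModEq.eq_of_lt_of_lt h2p hb₁ hb₂)
  · rintro ⟨y, hy⟩
    have hr : y.val < p := ZMod.val_lt y
    obtain ⟨b, hb2p, hbmod, hbcast⟩ : ∃ b : ℕ, b < 2 * p ∧ b % 2 = d % 2 ∧ ((b : ℕ) : ZMod p) = y := by
      by_cases h : y.val % 2 = d % 2
      · exact ⟨y.val, by omega, h, ZMod.natCast_zmod_val y⟩
      · refine ⟨y.val + p, by omega, by omega, ?_⟩
        push_cast
        rw [ZMod.natCast_zmod_val, ZMod.natCast_self, add_zero]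
    refine ⟨⟨b, hb2p, ?_⟩, Subtype.ext hbcast⟩
    have hpd : p ∣ b ^ 2 + d := by
      rw [← ZMod.natCast_eq_zero_iff]
      push_cast
      rw [hbcast, hy]; ring
    exact hcop4.mul_dvd_of_dvd_of_dvd (four_dvd_of_mod_two_eq hd hbmod) hpd

/-! ### The prime `2` -/

/-- `N(2)` as a decidable count over `𝔽₂²`. [cite: Cox2013, §7.D Exercise 7.29] -/
theorem card_normUnitPairs_two_eq (a c : ZMod 2) (ha : (t : ZMod 2) = a) (hc : (m : ZMod 2) = c) :
    Nat.card (NormUnitPairs t m 2) =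
      Fintype.card {uv : ZMod 2 × ZMod 2 // uv.1 ^ 2 + a * uv.1 * uv.2 - c * uv.2 ^ 2 ≠ 0} := by
  haveI : Fact (Nat.Prime 2) := ⟨Nat.prime_two⟩
  rw [← Nat.card_eq_fintype_card]
  unfold NormUnitPairs
  refine Nat.card_congr (Equiv.subtypeEquivRight fun uv => ?_)
  rw [normFormZMod, ha, hc]
  exact isUnit_iff_ne_zero

/-- The number of `b < 4` with `8 ∣ b² + d` depends only on `d mod 8`. [cite: Cox2013, §7.D Thm. 7.24 (the Kronecker symbol at 2)] -/
theorem card_filter_eight_dvd (d : ℕ) :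
    ((Finset.range 4).filter fun b => 8 ∣ b ^ 2 + d).card =
      ((Finset.range 4).filter fun b => (b ^ 2 % 8 + d % 8) % 8 = 0).card := by
  congr 1
  refine Finset.filter_congr fun b _ => ?_
  rw [Nat.dvd_iff_mod_eq_zero, Nat.add_mod]

/-- The set of the route statement at `p = 2` as a finset count. [cite: Cox2013, §7.D Thm. 7.24 (the Kronecker symbol at 2)] -/
theorem ncard_primeForms_two (d : ℕ) :
    Set.ncard {b : ℕ | b < 2 * 2 ∧ (4 * (2 : ℤ)) ∣ ((b : ℤ) ^ 2 + (d : ℤ))} =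
      ((Finset.range 4).filter fun b => (b ^ 2 % 8 + d % 8) % 8 = 0).card := by
  rw [← card_filter_eight_dvd]
  have : {b : ℕ | b < 2 * 2 ∧ (4 * (2 : ℤ)) ∣ ((b : ℤ) ^ 2 + (d : ℤ))} =
      ↑((Finset.range 4).filter fun b => 8 ∣ b ^ 2 + d) := by
    ext b
    simp only [Set.mem_setOf_eq, Finset.coe_filter, Finset.mem_range]
    rw [show (4 * (2 : ℤ)) = ((8 : ℕ) : ℤ) by norm_num,
      show ((b : ℤ) ^ 2 + (d : ℤ)) = ((b ^ 2 + d : ℕ) : ℤ) by push_cast; ring, Int.natCast_dvd_natCast]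
  rw [this, Set.ncard_coe_finset]

/-- **`N(2) + ρ₂ = 3`**: `p = 2` in the formula `N(p) = (p−1)(p + 1 − ρ_p)`, by the four parity cases of
`(t, m)` (`d ≡ 7, 3 (mod 8)` for `t` odd and `m` even, odd; `4 ∣ d` for `t` even).
[cite: Cox2013, §7.D Thm. 7.24 (the Kronecker symbol at 2)] -/
theorem card_normUnitPairs_two {d : ℕ} (hd : (t ^ 2 + 4 * m : ℤ) = -(d : ℤ)) :
    Nat.card (NormUnitPairs t m 2) + Set.ncard {b : ℕ | b < 2 * 2 ∧ (4 * (2 : ℤ)) ∣ ((b : ℤ) ^ 2 + (d : ℤ))} = 3 := by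
  rw [ncard_primeForms_two]
  have h2 : (2 : ZMod 2) = 0 := by decide
  rcases Int.even_or_odd t with ⟨k, hk⟩ | ⟨k, hk⟩
  · -- `t` even: `d ≡ 0 (mod 4)`, `ρ₂ = 1`, `N(2) = 2`
    have ht : (t : ZMod 2) = 0 := by rw [hk, show k + k = 2 * k by ring]; push_cast; rw [h2, zero_mul]
    have hd8 : d % 8 = 0 ∨ d % 8 = 4 := by
      have hdk : (d : ℤ) = -4 * (k ^ 2 + m) := by rw [← neg_neg (d : ℤ), ← hd, hk]; ring
      generalize k ^ 2 = K at hdk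
      omega
    rcases Int.even_or_odd m with ⟨j, hj⟩ | ⟨j, hj⟩
    · have hm : (m : ZMod 2) = 0 := by rw [hj, show j + j = 2 * j by ring]; push_cast; rw [h2, zero_mul]
      rw [card_normUnitPairs_two_eq t m 0 0 ht hm]
      rcases hd8 with h | h <;> rw [h] <;> decide
    · have hm : (m : ZMod 2) = 1 := by rw [hj]; push_cast; rw [h2, zero_mul, zero_add]
      rw [card_normUnitPairs_two_eq t m 0 1 ht hm]
      rcases hd8 with h | h <;> rw [h] <;> decide
  · -- `t` odd
    have ht : (t : ZMod 2) = 1 := by rw [hk]; push_cast; rw [h2, zero_mul, zero_add]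
    obtain ⟨i, hi⟩ := Int.even_mul_succ_self k
    have hdk : (d : ℤ) = -(8 * i + 1) - 4 * m := by
      rw [← neg_neg (d : ℤ), ← hd, hk]
      have : (2 * k + 1) ^ 2 = 4 * (k * (k + 1)) + 1 := by ring
      rw [this, hi]; ring
    rcases Int.even_or_odd m with ⟨j, hj⟩ | ⟨j, hj⟩
    · have hm : (m : ZMod 2) = 0 := by rw [hj, show j + j = 2 * j by ring]; push_cast; rw [h2, zero_mul]
      have hd8 : d % 8 = 7 := by omega
      rw [card_normUnitPairs_two_eq t m 1 0 ht hm, hd8]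
      decide
    · have hm : (m : ZMod 2) = 1 := by rw [hj]; push_cast; rw [h2, zero_mul, zero_add]
      have hd8 : d % 8 = 3 := by omega
      rw [card_normUnitPairs_two_eq t m 1 1 ht hm, hd8]
      decide

/-! ### Assembly: `N(f) = φ(f) ∏ p^{k−1}(p − (ρ_p − 1))` -/

/-- `d ≡ 0` or `3 (mod 4)` when `−d = t² + 4m`. [cite: Cox2013, §2.A (D ≡ 0, 1 mod 4)] -/
theorem mod_four_of_eq_neg {d : ℕ} (hd : (t ^ 2 + 4 * m : ℤ) = -(d : ℤ)) : d % 4 = 0 ∨ d % 4 = 3 := by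
  rcases Int.even_or_odd t with ⟨k, hk⟩ | ⟨k, hk⟩
  · have : (d : ℤ) = -4 * (k ^ 2 + m) := by rw [← neg_neg (d : ℤ), ← hd, hk]; ring
    generalize k ^ 2 = K at this
    omega
  · have : (d : ℤ) = -4 * (k ^ 2 + k + m) - 1 := by rw [← neg_neg (d : ℤ), ← hd, hk]; ring
    generalize k ^ 2 = K at this
    omega

/-- **The local factor**: for a prime `p` and `k ≥ 1`,
`N(p^k) = p^{k−1}(p − 1) · p^{k−1}(p − (ρ_p − 1))`, `ρ_p = #{b < 2p : 4p ∣ b² + d}`.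
[cite: Cox2013, §7.D Thm. 7.24] -/
theorem card_normUnitPairs_prime_pow_eq {d : ℕ} (hd : (t ^ 2 + 4 * m : ℤ) = -(d : ℤ)) {p k : ℕ} (hp : p.Prime)
    (hk : 0 < k) :
    (Nat.card (NormUnitPairs t m (p ^ k)) : ℤ) =
      ((p : ℤ) ^ (k - 1) * ((p : ℤ) - 1)) *
        ((p : ℤ) ^ (k - 1) * ((p : ℤ) -
          ((Set.ncard {b : ℕ | b < 2 * p ∧ (4 * (p : ℤ)) ∣ ((b : ℤ) ^ 2 + (d : ℤ))} : ℤ) - 1))) := by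
  haveI : Fact p.Prime := ⟨hp⟩
  rw [card_normUnitPairs_prime_pow t m hp hk]
  have hNp : (Nat.card (NormUnitPairs t m p) : ℤ) =
      ((p : ℤ) - 1) * ((p : ℤ) + 1 - (Set.ncard {b : ℕ | b < 2 * p ∧ (4 * (p : ℤ)) ∣ ((b : ℤ) ^ 2 + (d : ℤ))} : ℤ)) := by
    by_cases hp2 : p = 2
    · subst hp2
      have h := card_normUnitPairs_two t m hd
      have h' : (Nat.card (NormUnitPairs t m 2) : ℤ) + (Set.ncard {b : ℕ | b < 2 * 2 ∧ (4 * (2 : ℤ)) ∣ ((b : ℤ) ^ 2 + (d : ℤ))} : ℤ) = 3 := by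
        exact_mod_cast h
      simp only [Nat.cast_ofNat]
      linarith
    · have h := card_normUnitPairs_prime t m hp2
      have hρ := ncard_primeForms_eq hp2 (mod_four_of_eq_neg t m hd)
      have hcast : ((t ^ 2 + 4 * m : ℤ) : ZMod p) = -(d : ZMod p) := by rw [hd]; push_cast; ring
      rw [hcast] at h
      rw [hρ]
      have h' : (Nat.card (NormUnitPairs t m p) : ℤ) + (1 + ((p : ℤ) - 1) * (Nat.card {y : ZMod p // y ^ 2 = -(d : ZMod p)} : ℤ))
          = (p : ℤ) ^ 2 := by
        have hp1 : 1 ≤ p := hp.one_lt.le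
        have := congrArg (Nat.cast : ℕ → ℤ) h
        push_cast [Nat.cast_sub hp1] at this
        exact this
      linear_combination h'
  push_cast
  rw [hNp]
  ring

/-- **`#{(u,v) ∈ (ℤ/f)² : u² + tuv − mv² ∈ (ℤ/f)ˣ} = φ(f) · ∏_{p ∣ f} p^{k_p−1}(p − (ρ_p − 1))`** where
`ρ_p − 1 = #{b < 2p : 4p ∣ b² + d} − 1` is the Kronecker symbol `(−d/p)` and `−d = t² + 4m`
(Cox, Thm. 7.24: `|(𝒪_K/f𝒪_K)ˣ| = φ(f)·∏ p^{k−1}(p − (d_K/p))`). [cite: Cox2013, §7.D Thm. 7.24] -/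
theorem card_normUnitPairs_eq {d : ℕ} (hd : (t ^ 2 + 4 * m : ℤ) = -(d : ℤ)) {f : ℕ} (hf : f ≠ 0) :
    (Nat.card (NormUnitPairs t m f) : ℤ) =
      (Nat.totient f : ℤ) * ∏ p ∈ f.primeFactors, ((p : ℤ) ^ (f.factorization p - 1) *
        ((p : ℤ) - ((Set.ncard {b : ℕ | b < 2 * p ∧ (4 * (p : ℤ)) ∣ ((b : ℤ) ^ 2 + (d : ℤ))} : ℤ) - 1))) := by
  have hmult := Nat.multiplicative_factorization (fun n => Nat.card (NormUnitPairs t m n))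
    (fun x y hxy => card_normUnitPairs_mul t m hxy) (card_normUnitPairs_one t m) hf
  rw [hmult, Nat.prod_factorization_eq_prod_primeFactors, Nat.totient_eq_prod_factorization hf,
    Nat.prod_factorization_eq_prod_primeFactors]
  push_cast
  rw [← Finset.prod_mul_distrib]
  refine Finset.prod_congr rfl fun p hp => ?_
  have hpp : p.Prime := Nat.prime_of_mem_primeFactors hp
  have hk : 0 < f.factorization p := Nat.pos_of_ne_zero (Finsupp.mem_support_iff.1 hp)
  rw [card_normUnitPairs_prime_pow_eq t m hd hpp hk, Nat.cast_sub hpp.one_lt.le, Nat.cast_one]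

end Literature.NumberTheory.QuadraticFields.RingClass
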